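import Literature.NumberTheory.Automorphic.AdelicMatrixTwoConjugacy
import Literature.NumberTheory.Automorphic.GLnTrivialAtAwayUnits
import HarnessLib

/-!
# Conjugacy in `GL₂(𝔸_K^S)` of two matrices with the same separable rational characteristic polynomial
(Gelbart, *Automorphic forms on adele groups* (1975), §10, p. 155)

Topic `NumberTheory/Automorphic`; theorems only (no definition, no named fact, no instance).

Let `𝔸_K^S = AdeleAway K S = 𝔸_K ⧸ (e_S)` be the ring of adeles away from a finite set `S` of finite
places (`AdeleAwayFromPlaces`) and `t, n ∈ K` with `t² - 4n ≠ 0`. **Two matrices `M, N ∈ M₂(𝔸_K^S)`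
with trace `t` and determinant `n` are conjugate under `GL₂(𝔸_K^S)`** (`exists_units_conj_eq_adeleAway`):
lift the entries to `𝔸_K` (`AdeleAway.lift`, whose components away from `S` are those of any
representative), conjugate in `GL₂(𝔸_K)` at all places outside `S` (`exists_units_conj_eq_away`,
`AdelicMatrixTwoConjugacy`: local conjugacy everywhere, integral at almost all places), and reduce
modulo `e_S` (`GLn.awayProj`).

Use: for a quaternion algebra `D` split over `𝔸_K^S` by `Ψ` (`QuaternionAdeleAwaySplitting`), a
regular `γ' ∈ Dˣ` and the `γ ∈ GL₂(K)` with the same characteristic polynomial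
(`ScalarExtensionMatrixTraceDet`) give conjugate elements `Ψ(γ')`, `γ` of `GL₂(𝔸_K^S) ≅ G^S ≅ G'^S`, so
that the orbital integrals away from `S` in the elliptic terms of (10.14) and (10.15) can be
identified (Gelbart (1975), p. 155). Part of the inline (D-0026) decomposition of
`Literature.NumberTheory.Automorphic.strong_multiplicity_one_quaternionUnits`.

## References

* S. Gelbart, *Automorphic forms on adele groups*, Ann. of Math. Studies 83 (1975), §10, p. 155
  [Gelbart1975].
-/

noncomputable section

open NumberField IsDedekindDomain Matrix

namespace Literature.NumberTheory.Automorphic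

section Away

variable (K : Type) [Field K] [NumberField K] (S : Finset (HeightOneSpectrum (𝓞 K)))

/-- The components away from `S` of `lift (mk x)` are those of `x`. [folklore] -/
theorem adeleEval_lift_mk_of_not_mem {w : HeightOneSpectrum (𝓞 K)} (hw : w ∉ S) (x : AdeleRing (𝓞 K) K) :
    AdelicGroupData.adeleEval K w (AdeleAway.lift K S (AdeleAway.mk K S x)) = AdelicGroupData.adeleEval K w x := by
  rw [AdeleAway.lift_mk, map_mul, map_sub, map_one, adeleEval_adelePlacesIdem_of_not_mem hw, sub_zero, one_mul]

/-- The archimedean components of `lift (mk x)` are those of `x`. [folklore] -/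
theorem infiniteAdeleEval_lift_mk (w : InfinitePlace K) (x : AdeleRing (𝓞 K) K) :
    infiniteAdeleEval K w (AdeleAway.lift K S (AdeleAway.mk K S x)) = infiniteAdeleEval K w x := by
  rw [AdeleAway.lift_mk, map_mul, map_sub, map_one, infiniteAdeleEval_apply K w (adelePlacesIdem K S), adelePlacesIdem_fst]
  change ((1 : w.Completion) - 0) * _ = _
  rw [sub_zero, one_mul]

/-- The components away from `S` of `lift y` represent `y`: `lift` of a principal adele class. [folklore] -/
theorem adeleEval_lift_algebraMap_of_not_mem {w : HeightOneSpectrum (𝓞 K)} (hw : w ∉ S) (c : K) :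
    AdelicGroupData.adeleEval K w (AdeleAway.lift K S (algebraMap K (AdeleAway K S) c)) = algebraMap K (w.adicCompletion K) c := by
  rw [AdeleAway.algebraMap_eq, adeleEval_lift_mk_of_not_mem K S hw, adeleEval_algebraMap'']

/-- The archimedean components of `lift` of a principal adele class. [folklore] -/
theorem infiniteAdeleEval_lift_algebraMap (w : InfinitePlace K) (c : K) :
    infiniteAdeleEval K w (AdeleAway.lift K S (algebraMap K (AdeleAway K S) c)) = algebraMap K w.Completion c := by
  rw [AdeleAway.algebraMap_eq, infiniteAdeleEval_lift_mk, infiniteAdeleEval_algebraMap]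

/-- **Trace of the entrywise lift**: `tr (M.map lift) = lift (tr M)`. [folklore] -/
theorem trace_map_lift (M : Matrix (Fin 2) (Fin 2) (AdeleAway K S)) :
    (M.map (AdeleAway.lift K S)).trace = AdeleAway.lift K S M.trace :=
  (AddMonoidHom.map_trace (AdeleAway.lift K S) M).symm

/-- **Determinant of the entrywise lift**: `det (M.map lift) = lift (det M)` (`lift` is additive and
multiplicative, though not unital). [folklore] -/
theorem det_map_lift (M : Matrix (Fin 2) (Fin 2) (AdeleAway K S)) :
    (M.map (AdeleAway.lift K S)).det = AdeleAway.lift K S M.det := by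
  rw [Matrix.det_fin_two, Matrix.det_fin_two, map_sub, AdeleAway.lift_mul, AdeleAway.lift_mul]
  rfl

/-- Reduction of the entrywise lift: `(M.map lift).map mk = M`. [folklore] -/
theorem map_lift_map_mk (M : Matrix (Fin 2) (Fin 2) (AdeleAway K S)) :
    (M.map (AdeleAway.lift K S)).map (AdeleAway.mk K S) = M := by
  ext i j
  exact AdeleAway.mk_lift (M i j)

/-- Two adelic matrices agreeing at the infinite places and at the finite places outside `S` have the
same reduction in `M₂(𝔸_K^S)`. [folklore] -/
theorem map_mk_eq_map_mk_of_components {A B : Matrix (Fin 2) (Fin 2) (AdeleRing (𝓞 K) K)}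
    (hi : ∀ w : InfinitePlace K, A.map (infiniteAdeleEval K w) = B.map (infiniteAdeleEval K w))
    (hf : ∀ w : HeightOneSpectrum (𝓞 K), w ∉ S → A.map (AdelicGroupData.adeleEval K w) = B.map (AdelicGroupData.adeleEval K w)) :
    A.map (AdeleAway.mk K S) = B.map (AdeleAway.mk K S) := by
  ext i j
  rw [Matrix.map_apply, Matrix.map_apply, AdeleAway.mk_eq_mk_iff_components]
  refine ⟨funext fun w => ?_, fun w hw => ?_⟩
  · exact congrFun (congrFun (hi w) i) j
  · exact congrFun (congrFun (hf w hw) i) j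

/-- **Conjugacy in `GL₂(𝔸_K^S)`**: for `t, n ∈ K` with `t² - 4n ≠ 0`, two matrices `M, N ∈ M₂(𝔸_K^S)` with
trace `t` and determinant `n` are conjugate under `GL₂(𝔸_K^S)`. [cite: Gelbart1975, §10 p. 155] -/
theorem exists_units_conj_eq_adeleAway {t n : K} (hdisc : t ^ 2 - 4 * n ≠ 0) (M N : Matrix (Fin 2) (Fin 2) (AdeleAway K S))
    (hMt : M.trace = algebraMap K _ t) (hMd : M.det = algebraMap K _ n)
    (hNt : N.trace = algebraMap K _ t) (hNd : N.det = algebraMap K _ n) :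
    ∃ Q : GL (Fin 2) (AdeleAway K S),
      (Q : Matrix (Fin 2) (Fin 2) (AdeleAway K S)) * M * ((Q⁻¹ : GL (Fin 2) (AdeleAway K S)) : Matrix (Fin 2) (Fin 2) (AdeleAway K S)) = N := by
  set A := M.map (AdeleAway.lift K S) with hA
  set B := N.map (AdeleAway.lift K S) with hB
  -- local traces and determinants of the lifts
  have hcomp : ∀ (P : Matrix (Fin 2) (Fin 2) (AdeleAway K S)), P.trace = algebraMap K _ t → P.det = algebraMap K _ n →
      (∀ w : InfinitePlace K, ((P.map (AdeleAway.lift K S)).map (infiniteAdeleEval K w)).trace = algebraMap K _ t ∧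
        ((P.map (AdeleAway.lift K S)).map (infiniteAdeleEval K w)).det = algebraMap K _ n) ∧
      ∀ w : HeightOneSpectrum (𝓞 K), w ∉ S → ((P.map (AdeleAway.lift K S)).map (AdelicGroupData.adeleEval K w)).trace = algebraMap K _ t ∧
        ((P.map (AdeleAway.lift K S)).map (AdelicGroupData.adeleEval K w)).det = algebraMap K _ n := by
    intro P hPt hPd
    refine ⟨fun w => ⟨?_, ?_⟩, fun w hw => ⟨?_, ?_⟩⟩
    · rw [← AddMonoidHom.map_trace, trace_map_lift, hPt, infiniteAdeleEval_lift_algebraMap]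
    · rw [← RingHom.mapMatrix_apply, ← RingHom.map_det, det_map_lift, hPd, infiniteAdeleEval_lift_algebraMap]
    · rw [← AddMonoidHom.map_trace, trace_map_lift, hPt, adeleEval_lift_algebraMap_of_not_mem K S hw]
    · rw [← RingHom.mapMatrix_apply, ← RingHom.map_det, det_map_lift, hPd, adeleEval_lift_algebraMap_of_not_mem K S hw]
  obtain ⟨hAi, hAf⟩ := hcomp M hMt hMd
  obtain ⟨hBi, hBf⟩ := hcomp N hNt hNd
  obtain ⟨Q, hQi, hQf⟩ := exists_units_conj_eq_away K S hdisc A B hAi hBi hAf hBf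
  set q : Matrix (Fin 2) (Fin 2) (AdeleRing (𝓞 K) K) →* Matrix (Fin 2) (Fin 2) (AdeleAway K S) :=
    (GLn.awayProj 2 K S).toMonoidHom with hq
  refine ⟨Units.map q Q, ?_⟩
  have hred := map_mk_eq_map_mk_of_components K S hQi hQf
  rw [Matrix.map_mul, Matrix.map_mul, hA, hB, map_lift_map_mk, map_lift_map_mk] at hred
  have h1 : ((Units.map q Q : GL (Fin 2) (AdeleAway K S)) : Matrix (Fin 2) (Fin 2) (AdeleAway K S)) =
      (Q : Matrix (Fin 2) (Fin 2) (AdeleRing (𝓞 K) K)).map (AdeleAway.mk K S) := rfl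
  have h2 : (((Units.map q Q)⁻¹ : GL (Fin 2) (AdeleAway K S)) : Matrix (Fin 2) (Fin 2) (AdeleAway K S)) =
      ((Q⁻¹ : GL (Fin 2) (AdeleRing (𝓞 K) K)) : Matrix (Fin 2) (Fin 2) (AdeleRing (𝓞 K) K)).map (AdeleAway.mk K S) := by
    rw [← map_inv]
    rfl
  rw [h1, h2]
  exact hred

end Away

end Literature.NumberTheory.Automorphic
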